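import Literature.Probability.Percolation.LowestCrossing
import HarnessLib

/-!
# Column events of the five-arm construction for bond percolation on `ℤ²` (definitions)

Topic `Literature/Probability/Percolation`. Definitions (with their locality) for the five-arm
lower bound for bond percolation on `ℤ²` in the bottom-up layers towards
`Kesten1987_zdKestenRelation` (`ZdNearCriticalWindow.lean`): Nolin's two vertical paths of the
thin columns joining the top side to the lowest crossing (Nolin 2008, §5.2, proof of Thm. 24 (ii)
[arXiv 0711.4948: Thm. 23 (ii)]: "with positive probability `c` is connected to the top side by a
black path included in `[-N/8,0] × [-N,N]`, and another white path included in
`[0,N/8] × [-N,N]`"), in the colour-swapped bond rendering where the explored object is the open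
cluster `O₀` of the bottom side of `R = [0,m] × [0,n]` (`bottomCluster`, `ZdBottomCluster.lean`).
Both events are indexed by the data `O₀` and read only pairs of sites OFF `O₀` (`offPairs`), so
that Kesten's decoupling (conditionally on the explored data "percolation there remains
unbiased") applies through `bondPercolation_real_inter_of_disjoint`:

* `colPathToCluster m n a b O₀` — an open lattice walk inside the column `[a,b] × [0,n]` from a
  top site of `R` to a site adjacent to `O₀`, through sites off `O₀`;
* `colDualPathToCluster m n a b O₀` — a walk of faces of the face column `[a,b-1] × [-1,n]` from
  the top face row, each step crossing a CLOSED edge of `R` with endpoints off `O₀`, ending at a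
  face with a bounding edge incident to `O₀`;
* `offPairs m n a b O₀` — the pairs of column sites off `O₀`; `dualColumnCrossing n a b` — the
  closed dual top–bottom crossing of the column (a translate of `dualTBCrossing (b-a) n`);
* locality: `determinedBy_colPathToCluster`, `determinedBy_colDualPathToCluster` (both by
  `offPairs`), measurability; `ZdDual.sep_cases` (coordinates of the edge separating two faces).

The implications "full crossing of the column ⇒ event" and the probabilities are in
`ZdFiveArmColumnPath.lean` / `ZdFiveArmColumnDualPath.lean`.
-/

noncomputable section

open MeasureTheory Set SimpleGraph

namespace Literature.Probability.Percolation

open LatticeModels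

variable {m n a b : ℕ} {O₀ : Finset (Site 2)} {ω : BondConfig (Site 2)}

/-! ### The open column path -/

/-- **The open column path down to the cluster** (Nolin 2008, proof of Thm. 24 (ii): the black
path of the left column from the top side to the lowest crossing; colour-swapped bond form): an
open lattice walk from a site of the top side of `R = [0,m] × [0,n]` with abscissa in `[a, b]` to a
site `u`, inside the column `[a,b] × [0,n]`, through sites outside `O₀` only, with `u` adjacent in
`ℤ²` to a site of `O₀`. [cite: Nolin2008, §5.2, proof of Thm. 24 (ii) (arXiv 0711.4948: Thm. 23 (ii))] -/
def colPathToCluster (m n a b : ℕ) (O₀ : Finset (Site 2)) : Set (BondConfig (Site 2)) :=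
  {ω | ∃ (t u : Site 2) (γ : (zdGraph 2).Walk t u), t ∈ topSide m n ∧
    (∀ z ∈ γ.support, z ∈ rectangle m n ∧ (a : ℤ) ≤ z 0 ∧ z 0 ≤ b ∧ z ∉ O₀) ∧
    (∀ e ∈ γ.edges, e ∈ ω) ∧ ∃ o ∈ O₀, (zdGraph 2).Adj u o}

open Classical in
/-- The pairs of sites of the column `[a,b] × [0,n]` of `R` with both endpoints outside `O₀`: the
coordinates read by `colPathToCluster`. [folklore] -/
def offPairs (m n a b : ℕ) (O₀ : Finset (Site 2)) : Finset (Sym2 (Site 2)) :=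
  (rectangle m n).sym2.filter fun e => ∀ x ∈ e, (a : ℤ) ≤ x 0 ∧ x 0 ≤ b ∧ x ∉ O₀

/-- **The column event is determined by the pairs off `O₀`.** [folklore] -/
theorem determinedBy_colPathToCluster (m n a b : ℕ) (O₀ : Finset (Site 2)) :
    DeterminedBy (colPathToCluster m n a b O₀) ↑(offPairs m n a b O₀) := by
  classical
  suffices key : ∀ ω ω' : BondConfig (Site 2), ω ∩ ↑(offPairs m n a b O₀) = ω' ∩ ↑(offPairs m n a b O₀) →
      ω ∈ colPathToCluster m n a b O₀ → ω' ∈ colPathToCluster m n a b O₀ by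
    rw [determinedBy_iff]
    exact fun ω ω' h => ⟨key ω ω' h, key ω' ω h.symm⟩
  rintro ω ω' h ⟨t, u, γ, ht, hγs, hγe, o, ho, huo⟩
  refine ⟨t, u, γ, ht, hγs, fun e he => ?_, o, ho, huo⟩
  suffices heF : e ∈ offPairs m n a b O₀ from ((Set.ext_iff.1 h e).1 ⟨hγe e he, heF⟩).1
  rw [Walk.edges, List.mem_map] at he
  obtain ⟨d, hd, rfl⟩ := he
  have h1 := hγs _ (γ.dart_fst_mem_support_of_mem_darts hd)
  have h2 := hγs _ (γ.dart_snd_mem_support_of_mem_darts hd)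
  rw [offPairs, Finset.mem_filter, Dart.edge, Finset.mk_mem_sym2_iff]
  refine ⟨⟨h1.1, h2.1⟩, fun x hx => ?_⟩
  rcases Sym2.mem_iff.1 hx with rfl | rfl
  · exact h1.2
  · exact h2.2

/-- The column event is a local event. [folklore] -/
theorem isLocalEvent_colPathToCluster (m n a b : ℕ) (O₀ : Finset (Site 2)) :
    IsLocalEvent (colPathToCluster m n a b O₀) :=
  ⟨_, determinedBy_colPathToCluster m n a b O₀⟩

/-- The column event is measurable. [folklore] -/
theorem measurableSet_colPathToCluster (m n a b : ℕ) (O₀ : Finset (Site 2)) :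
    MeasurableSet (colPathToCluster m n a b O₀) :=
  (determinedBy_colPathToCluster m n a b O₀).measurableSet_of_finset

/-! ### The closed dual column path -/

/-- Coordinates of the edge separating two adjacent faces `z`, `z'` (lower-left corners), in the
four possible directions of the step `z → z'` (right, left, up, down). [folklore] -/
theorem ZdDual.sep_cases {z z' : Site 2} (h : (zdGraph 2).Adj z z') :
    (z' 0 = z 0 + 1 ∧ z' 1 = z 1 ∧ sepLo z z' 0 = z 0 + 1 ∧ sepLo z z' 1 = z 1 ∧
        sepHi z z' 0 = z 0 + 1 ∧ sepHi z z' 1 = z 1 + 1) ∨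
    (z 0 = z' 0 + 1 ∧ z' 1 = z 1 ∧ sepLo z z' 0 = z 0 ∧ sepLo z z' 1 = z 1 ∧
        sepHi z z' 0 = z 0 ∧ sepHi z z' 1 = z 1 + 1) ∨
    (z' 1 = z 1 + 1 ∧ z' 0 = z 0 ∧ sepLo z z' 0 = z 0 ∧ sepLo z z' 1 = z 1 + 1 ∧
        sepHi z z' 0 = z 0 + 1 ∧ sepHi z z' 1 = z 1 + 1) ∨
    (z 1 = z' 1 + 1 ∧ z' 0 = z 0 ∧ sepLo z z' 0 = z 0 ∧ sepLo z z' 1 = z 1 ∧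
        sepHi z z' 0 = z 0 + 1 ∧ sepHi z z' 1 = z 1) := by
  rcases stepKind_of_adj h with ⟨h0, h1⟩ | ⟨h0, h1⟩ | ⟨h1, h0⟩ | ⟨h1, h0⟩
  · obtain rfl : z' = z + Pi.single 0 1 := by simp [LatticeModels.Site.eq_iff_two, h0, h1]
    refine Or.inl ⟨h0, h1, ?_, ?_, ?_, ?_⟩ <;> simp [sepLo_add_e0, sepHi_add_e0]
  · obtain rfl : z = z' + Pi.single 0 1 := by simp [LatticeModels.Site.eq_iff_two, h0, h1]
    refine Or.inr (Or.inl ⟨h0, h1, ?_, ?_, ?_, ?_⟩) <;>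
      simp [sepLo_comm (z' + Pi.single 0 1), sepHi_comm (z' + Pi.single 0 1), sepLo_add_e0,
        sepHi_add_e0]
  · obtain rfl : z' = z + Pi.single 1 1 := by simp [LatticeModels.Site.eq_iff_two, h0, h1]
    refine Or.inr (Or.inr (Or.inl ⟨h1, h0, ?_, ?_, ?_, ?_⟩)) <;>
      simp [sepLo_add_e1, sepHi_add_e1]
  · obtain rfl : z = z' + Pi.single 1 1 := by simp [LatticeModels.Site.eq_iff_two, h0, h1]
    refine Or.inr (Or.inr (Or.inr ⟨h1, h0, ?_, ?_, ?_, ?_⟩)) <;>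
      simp [sepLo_comm (z' + Pi.single 1 1), sepHi_comm (z' + Pi.single 1 1), sepLo_add_e1,
        sepHi_add_e1]

/-- A dual-open pair of adjacent faces crosses a closed primal edge: if `{z, z'} ∈ dualConfig ω`
then `sepEdge z z' ∉ ω`. [folklore] -/
theorem ZdDual.sepEdge_not_mem_of_mem_dualConfig {z z' : Site 2} (h : (zdGraph 2).Adj z z')
    (hd : s(z, z') ∈ dualConfig ω) : sepEdge z z' ∉ ω := fun he =>
  (mem_dualConfig_iff.1 hd).2 _ he (dualEdge_sepEdge h)

/-! ### The event -/

/-- **The closed dual column path down to the cluster** (Nolin 2008, proof of Thm. 24 (ii): the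
white path of the right column from the top side to the lowest crossing; colour-swapped bond
form): a walk of faces from a face of the top face row (`y = n`) inside the face column
`[a, b-1] × [-1, n]`, every step of which crosses an edge of `R = [0,m] × [0,n]` that is closed
and has both endpoints off `O₀`, ending at a face one of whose bounding edges is incident to
`O₀`. [cite: Nolin2008, §5.2, proof of Thm. 24 (ii) (arXiv 0711.4948: Thm. 23 (ii))] -/
def colDualPathToCluster (m n a b : ℕ) (O₀ : Finset (Site 2)) : Set (BondConfig (Site 2)) :=
  {ω | ∃ (f₀ f₁ : Site 2) (δ : (zdGraph 2).Walk f₀ f₁), f₀ 1 = n ∧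
    (∀ z ∈ δ.support, (a : ℤ) ≤ z 0 ∧ z 0 + 1 ≤ b ∧ -1 ≤ z 1 ∧ z 1 ≤ n) ∧
    (∀ d ∈ δ.darts, sepLo d.fst d.snd ∈ rectangle m n ∧ sepHi d.fst d.snd ∈ rectangle m n ∧
      sepLo d.fst d.snd ∉ O₀ ∧ sepHi d.fst d.snd ∉ O₀ ∧ sepEdge d.fst d.snd ∉ ω) ∧
    ∃ f' : Site 2, (zdGraph 2).Adj f₁ f' ∧ (sepLo f₁ f' ∈ O₀ ∨ sepHi f₁ f' ∈ O₀)}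

/-- **The dual column event is determined by the pairs of the column off `O₀`** (`offPairs`,
`ZdFiveArmColumnPath.lean`): every step crosses an edge of `R` with both endpoints of abscissa in
`[a, b]` (the faces have abscissa in `[a, b-1]`) and off `O₀`. [folklore] -/
theorem determinedBy_colDualPathToCluster (m n a b : ℕ) (O₀ : Finset (Site 2)) :
    DeterminedBy (colDualPathToCluster m n a b O₀) ↑(offPairs m n a b O₀) := by
  classical
  suffices key : ∀ ω ω' : BondConfig (Site 2), ω ∩ ↑(offPairs m n a b O₀) = ω' ∩ ↑(offPairs m n a b O₀) →
      ω ∈ colDualPathToCluster m n a b O₀ → ω' ∈ colDualPathToCluster m n a b O₀ by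
    rw [determinedBy_iff]
    exact fun ω ω' h => ⟨key ω ω' h, key ω' ω h.symm⟩
  rintro ω ω' h ⟨f₀, f₁, δ, hf₀, hδs, hδd, f', hf', hland⟩
  refine ⟨f₀, f₁, δ, hf₀, hδs, fun d hd => ?_, f', hf', hland⟩
  obtain ⟨hlo, hhi, hloO, hhiO, hcl⟩ := hδd d hd
  refine ⟨hlo, hhi, hloO, hhiO, fun he => hcl ?_⟩
  obtain ⟨h1a, h1b, -, -⟩ := hδs _ (δ.dart_fst_mem_support_of_mem_darts hd)
  obtain ⟨h2a, h2b, -, -⟩ := hδs _ (δ.dart_snd_mem_support_of_mem_darts hd)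
  have hx : ∀ x ∈ sepEdge d.fst d.snd, (a : ℤ) ≤ x 0 ∧ x 0 ≤ b := by
    intro x hx
    rw [sepEdge, Sym2.mem_iff] at hx
    rcases ZdDual.sep_cases d.adj with ⟨-, -, hlo0, -, hhi0, -⟩ | ⟨-, -, hlo0, -, hhi0, -⟩ |
        ⟨-, -, hlo0, -, hhi0, -⟩ | ⟨-, -, hlo0, -, hhi0, -⟩
    all_goals
      rcases hx with rfl | rfl
      · rw [hlo0]; omega
      · rw [hhi0]; omega
  have heF : sepEdge d.fst d.snd ∈ offPairs m n a b O₀ := by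
    rw [offPairs, Finset.mem_filter]
    refine ⟨?_, fun x hx' => ⟨(hx x hx').1, (hx x hx').2, ?_⟩⟩
    · rw [sepEdge, Finset.mk_mem_sym2_iff]; exact ⟨hlo, hhi⟩
    · rw [sepEdge, Sym2.mem_iff] at hx'
      rcases hx' with rfl | rfl
      · exact hloO
      · exact hhiO
  exact ((Set.ext_iff.1 h _).2 ⟨he, heF⟩).1

/-- The dual column event is measurable. [folklore] -/
theorem measurableSet_colDualPathToCluster (m n a b : ℕ) (O₀ : Finset (Site 2)) :
    MeasurableSet (colDualPathToCluster m n a b O₀) :=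
  (determinedBy_colDualPathToCluster m n a b O₀).measurableSet_of_finset

/-- The closed dual top–bottom crossing of the column `[a, b] × [0, n]`: a dual-open path of faces
of the shifted dual rectangle `[a, b-1] × [-1, n]` from its top face row to its bottom face row
(the tree's `dualTBCrossing (b - a) n`, translated by `(a, 0)`). [folklore] -/
def dualColumnCrossing (n a b : ℕ) : Set (BondConfig (Site 2)) :=
  dualConfig ⁻¹' openCrossing ((· + (![(a : ℤ), 0] : Site 2)) '' (↑(dualRectangle (b - a) n) : Set (Site 2)))
    ((· + (![(a : ℤ), 0] : Site 2)) '' (↑(dualTopSide (b - a) n) : Set (Site 2)))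
    ((· + (![(a : ℤ), 0] : Site 2)) '' (↑(dualBottomSide (b - a) n) : Set (Site 2)))

/-- The closed dual column crossing is measurable. [folklore] -/
theorem measurableSet_dualColumnCrossing (n a b : ℕ) : MeasurableSet (dualColumnCrossing n a b) := by
  unfold dualColumnCrossing
  have : ((· + (![(a : ℤ), 0] : Site 2)) '' (↑(dualRectangle (b - a) n) : Set (Site 2))) =
      ↑((dualRectangle (b - a) n).image (· + (![(a : ℤ), 0] : Site 2))) := Finset.coe_image.symm
  rw [this]
  exact (measurableSet_openCrossing _ _ _).preimage measurable_dualConfig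

end Literature.Probability.Percolation
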